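import Mathlib.Topology.Order.Compact
import Literature.Analysis.FluidPDE.NSCoriolisTorus
import HarnessLib

/-!
# Dissipation controls the gradient at good times (Babin–Mahalov–Nicolaenko (5.41)–(5.42))

Analysis/FluidPDE proof file (theorems only; no definitions, no named facts), sequel of
`NSCoriolisTorus.lean`, supporting the named fact
`Literature.Analysis.FluidPDE.bmn1999_rotating_ns_global_regularity` (Babin–Mahalov–Nicolaenko,
Indiana Univ. Math. J. 48 (1999), Thm. 1.1 = Thm. 5.3). It formalises the step of the proof of
Thm. 5.3 (p. 1170) which restarts the argument from times of controlled `H¹` norm: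

"We have the energy estimate for regular solutions: `‖U(t)‖₀ ≤ M₀` (5.41),
`ν ∫_T^{T+τ} ‖U(t)‖₁² ≤ M₀²` (5.42) … For every `t ≥ τ`, Eq. (5.42) implies that on every interval
`[t − τ, t]` including `t = τ`, we have a point `t*` for which `‖U(t*)‖₁ ≤ M₀/√(ντ)`. … For every
`t ≥ T_α`, we take `U(t*)` as new initial data".

For a `ℤ³`-periodic classical solution of the unforced rotating system read on the torus
(`IsClassicalNSCoriolisSolutionOn S ν Ω 0 (lift ∘ u) (lift ∘ p)`, `S` a convex time set):

* `torus_mul_intervalIntegral_gradNormSq_le` — **(5.42)**: `ν ∫ₛᵗ ‖∇u‖₂² ≤ ½‖u(s)‖₂²` for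
  `[s, t] ⊆ S` (the energy equality `torus_energy_eq` with no force and no `Ω`, and `½‖u(t)‖² ≥ 0`);
* `exists_mem_Icc_gradNormSq_le` — **good times**: for `ν > 0` and `s < t` with `[s, t] ⊆ S` there
  is `t* ∈ [s, t]` with `‖∇u(t*)‖₂² ≤ ½‖u(s)‖₂² / (ν (t − s))` (a continuous function does not exceed
  its mean everywhere: `t ↦ ‖∇u(t)‖₂²` is continuous, `Torus.IsSmoothSpaceTimeOn.continuousOn_gradNormSq`,
  attains its minimum on `[s, t]`, and the minimum times `t − s` is at most the integral);
* `exists_mem_Icc_gradNormSq_le_of_anchor` — the same with the energy taken at any earlier anchor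
  `t₀ ≤ s` of `S` (`½‖u(s)‖² ≤ ½‖u(t₀)‖²`, `torus_kineticEnergy_le`): with `M₀² = ‖u(t₀)‖₂²` this
  is BMN's `‖U(t*)‖₁ ≤ M₀/√(ντ)` (indeed `≤ M₀/√(2ντ)`), uniformly in `Ω`.

## Mathlib / tree search

Mathlib: `IsCompact.exists_isMinOn`, `intervalIntegral.integral_mono_on`,
`intervalIntegral.integral_const`. Tree (reused): `IsClassicalNSCoriolisSolutionOn.torus_energy_eq`,
`torus_kineticEnergy_le`, `to_torus` (`NSCoriolisTorus`), `Torus.IsSmoothSpaceTimeOn.continuousOn_gradNormSq`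
(`TorusClassicalLerayHopfProofs`), `Torus.kineticEnergy_nonneg`, `Torus.gradNormSq_nonneg`
(`TorusFluidGlue`). No "good time" selection lemma in the tree (searched `exists.*gradNormSq_le`,
`Chebyshev` with `intervalIntegral`).

## References

* A. Babin, A. Mahalov, B. Nicolaenko, *Global regularity of 3D rotating Navier–Stokes equations
  for resonant domains*, Indiana Univ. Math. J. 48 (1999) 1133–1176, proof of Thm. 5.3,
  (5.41)–(5.42) and the choice of `t*` (p. 1170). [BabinMahalovNicolaenko1999]
-/

noncomputable section

open MeasureTheory Set Function
open scoped ContDiff InnerProductSpace RealInnerProductSpace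

namespace Literature.Analysis.FluidPDE

namespace IsClassicalNSCoriolisSolutionOn

variable {S : Set ℝ} {ν Ω : ℝ} {u : ℝ → UnitAddTorus (Fin 3) → EuclideanSpace ℝ (Fin 3)}
  {p : ℝ → UnitAddTorus (Fin 3) → ℝ}

/-- **BMN (5.42): the dissipation on a time window is bounded by the initial energy of the
window.** For a periodic classical solution of the unforced rotating system on a convex time set
`S` and `[s, t] ⊆ S`: `ν ∫ₛᵗ ‖∇u(τ)‖₂² dτ ≤ ½‖u(s)‖₂²` (energy equality without force and without
`Ω`, `torus_energy_eq`, and `½‖u(t)‖₂² ≥ 0`). [cite: BabinMahalovNicolaenko1999, (5.41)–(5.42)] -/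
theorem torus_mul_intervalIntegral_gradNormSq_le
    (h : IsClassicalNSCoriolisSolutionOn S ν Ω 0 (fun t => FunctionSpaces.Torus.lift (u t))
      (fun t => FunctionSpaces.Torus.lift (p t)))
    (hS : Convex ℝ S) {s t : ℝ} (hst : s ≤ t) (hI : Icc s t ⊆ S) :
    ν * ∫ τ in s..t, FunctionSpaces.Torus.gradNormSq (u τ) ≤
      FunctionSpaces.Torus.kineticEnergy (u s) := by
  have h0 : IsClassicalNSCoriolisSolutionOn S ν Ω
      (fun t => FunctionSpaces.Torus.lift
        ((0 : ℝ → UnitAddTorus (Fin 3) → EuclideanSpace ℝ (Fin 3)) t))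
      (fun t => FunctionSpaces.Torus.lift (u t)) (fun t => FunctionSpaces.Torus.lift (p t)) := h
  have h1 := torus_energy_eq h0 hS hst hI
  simp only [Pi.zero_apply, inner_zero_left, integral_zero, intervalIntegral.integral_zero,
    add_zero] at h1
  linarith [FunctionSpaces.Torus.kineticEnergy_nonneg (u t)]

/-- **Good times** (BMN 1999, p. 1170: "Eq. (5.42) implies that on every interval `[t − τ, t]` …
we have a point `t*` for which `‖U(t*)‖₁ ≤ M₀/√(ντ)`"). For a periodic classical solution of the
unforced rotating system with `ν > 0` on a convex time set `S`, and `s < t` with `[s, t] ⊆ S`,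
there is `t* ∈ [s, t]` with `‖∇u(t*)‖₂² ≤ ½‖u(s)‖₂² / (ν (t − s))`: the continuous function
`τ ↦ ‖∇u(τ)‖₂²` attains its minimum on `[s, t]`, and `(t − s) · min ≤ ∫ₛᵗ ‖∇u‖₂² ≤ ½‖u(s)‖₂²/ν`.
[cite: BabinMahalovNicolaenko1999, proof of Thm. 5.3, (5.42) and the choice of t* (p. 1170)] -/
theorem exists_mem_Icc_gradNormSq_le
    (h : IsClassicalNSCoriolisSolutionOn S ν Ω 0 (fun t => FunctionSpaces.Torus.lift (u t))
      (fun t => FunctionSpaces.Torus.lift (p t)))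
    (hν : 0 < ν) (hS : Convex ℝ S) {s t : ℝ} (hst : s < t) (hI : Icc s t ⊆ S) :
    ∃ t' ∈ Icc s t, FunctionSpaces.Torus.gradNormSq (u t') ≤
      FunctionSpaces.Torus.kineticEnergy (u s) / (ν * (t - s)) := by
  have h0 : IsClassicalNSCoriolisSolutionOn S ν Ω
      (fun t => FunctionSpaces.Torus.lift
        ((0 : ℝ → UnitAddTorus (Fin 3) → EuclideanSpace ℝ (Fin 3)) t))
      (fun t => FunctionSpaces.Torus.lift (u t)) (fun t => FunctionSpaces.Torus.lift (p t)) := h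
  have hU : UniqueDiffOn ℝ S := by
    refine uniqueDiffOn_convex hS ((nonempty_Ioo.2 hst).mono ?_)
    rw [← interior_Icc]
    exact interior_mono hI
  have hG : ContinuousOn (fun τ => FunctionSpaces.Torus.gradNormSq (u τ)) (Icc s t) :=
    (h0.to_torus.smooth_velocity.continuousOn_gradNormSq hS hU).mono hI
  obtain ⟨t', ht', hmin⟩ := isCompact_Icc.exists_isMinOn (nonempty_Icc.2 hst.le) hG
  refine ⟨t', ht', ?_⟩
  have hGi : IntervalIntegrable (fun τ => FunctionSpaces.Torus.gradNormSq (u τ)) volume s t :=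
    (hG.mono (by rw [uIcc_of_le hst.le])).intervalIntegrable
  have hlow : (t - s) * FunctionSpaces.Torus.gradNormSq (u t') ≤
      ∫ τ in s..t, FunctionSpaces.Torus.gradNormSq (u τ) := by
    have hmono := intervalIntegral.integral_mono_on hst.le intervalIntegrable_const hGi
      (fun x hx => (isMinOn_iff.1 hmin) x hx)
    rwa [intervalIntegral.integral_const, smul_eq_mul] at hmono
  have hdiss := torus_mul_intervalIntegral_gradNormSq_le h hS hst.le hI
  rw [le_div_iff₀ (mul_pos hν (sub_pos.2 hst))]
  nlinarith [hlow, hdiss, hν, mul_le_mul_of_nonneg_left hlow hν.le]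

/-- **Good times, energy taken at an anchor** (BMN 1999, (5.41)–(5.42) and the choice of `t*`,
p. 1170, with `M₀² = ‖u(t₀)‖₂²`): for a periodic classical solution of the unforced rotating system
with `ν > 0` on a convex time set `S`, an anchor `t₀ ∈ S` and a window `[s, t]`, `t₀ ≤ s < t`,
`[t₀, t] ⊆ S`, there is `t* ∈ [s, t]` with `‖∇u(t*)‖₂² ≤ ½‖u(t₀)‖₂² / (ν (t − s))` — uniformly in
the Coriolis parameter `Ω` (the energy does not increase, `torus_kineticEnergy_le`).
[cite: BabinMahalovNicolaenko1999, proof of Thm. 5.3, (5.41)–(5.42) (p. 1170)] -/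
theorem exists_mem_Icc_gradNormSq_le_of_anchor
    (h : IsClassicalNSCoriolisSolutionOn S ν Ω 0 (fun t => FunctionSpaces.Torus.lift (u t))
      (fun t => FunctionSpaces.Torus.lift (p t)))
    (hν : 0 < ν) (hS : Convex ℝ S) {t₀ s t : ℝ} (h₀s : t₀ ≤ s) (hst : s < t)
    (hI : Icc t₀ t ⊆ S) :
    ∃ t' ∈ Icc s t, FunctionSpaces.Torus.gradNormSq (u t') ≤
      FunctionSpaces.Torus.kineticEnergy (u t₀) / (ν * (t - s)) := by
  have hIst : Icc s t ⊆ S := (Icc_subset_Icc_left h₀s).trans hI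
  have hI0s : Icc t₀ s ⊆ S := (Icc_subset_Icc_right hst.le).trans hI
  obtain ⟨t', ht', hle⟩ := exists_mem_Icc_gradNormSq_le h hν hS hst hIst
  refine ⟨t', ht', hle.trans ?_⟩
  have hE := torus_kineticEnergy_le h hν.le hS h₀s hI0s
  exact div_le_div_of_nonneg_right hE (mul_pos hν (sub_pos.2 hst)).le

end IsClassicalNSCoriolisSolutionOn

end Literature.Analysis.FluidPDE

end
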